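import Summits.Ventures.PercRepro.ProfilePointedCircuitClassesStarSharpS

/-!
# PercRepro — THE SERIES-TWIN REGIME OF `StarNineSharp`, II: THE THREE KINDS OF DEMAND AND THEIR IMAGES
(p5, gen 53; `proofs/P5-GM1.md` §80 ADD 4 case C, Sharp layer; continues StarSharpS)

With `E₇ := E − b − b′`, `H := E₇ − f − z` for a series twin `z` of `f` in `R = N ∖ {b, b′}`, and `𝒲 := BI_4(N)`:
* `compl_erase_mem_of_subset_E7`: a set `W ∈ 𝒲` inside `E₇` is OFF — `(E ∖ W) − b′ = (E₇ ∖ W) + b ∈ 𝒲`;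
  `compl_erase_erase`: the complement map is an involution on the sets avoiding `b′`;
* `swap_mem_of_seriesTwin`: for `W ∈ 𝒲` with `b, z ∈ W` and `b′, f ∉ W`, the series swap `W − z + f` is in `𝒲`
  (StarSharpS's `swap_rk_of_seriesTwin` through the lift `insert_b_mem_biIndepSets_iff`);
* `h_images_of_seriesTwin`: for an ON demand `Y + b` with `Y ⊆ H`, `(H ∖ Y) + f + b ∈ 𝒲`, and either it is ON
  (`ρ((H ∖ Y) ∪ {f, b, b′}) = 4`) or `Y + f ∈ 𝒲` — by the cut lemma.
The injections are assembled in StarSharpU.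
-/

open scoped Matroid

namespace PercRepro.Cogirth

open Finset ThmH Skew Shadow Profile

variable {α : Type} [DecidableEq α] {N : Matroid α} [N.Finite]

section StarSharpT

variable {b b' : α}

/-! ### The three kinds of demand -/

/-- A bi-independent `4`-set `W ⊆ E₇` is «OFF»: `(E ∖ W) − b′ = (E₇ ∖ W) + b` is bi-independent as well
(`ρ(E₇ ∖ W) = 3` since `(E₇ ∖ W) ∪ {b, b′}` has rank `5`). -/
theorem compl_erase_mem_of_subset_E7 (h : SeriesPair N b b') (hn : (gr N).card = 9) {W : Finset α}
    (hW : W ∈ biIndepSets N 4) (hbW : b ∉ W) (hb'W : b' ∉ W) : (gr N \ W).erase b' ∈ biIndepSets N 4 := by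
  have hb : b ∈ gr N := h.1
  have hb' : b' ∈ gr N := h.2.1
  have hbb' : b ≠ b' := h.2.2.1
  obtain ⟨hWg, hW4, -, -⟩ := mem_biIndepSets.1 hW
  have hWE : W ⊆ ((gr N).erase b).erase b' := fun x hx =>
    mem_erase.2 ⟨fun h' => hb'W (h' ▸ hx), mem_erase.2 ⟨fun h' => hbW (h' ▸ hx), hWg hx⟩⟩
  obtain ⟨hWr, hWc⟩ := (mem_biIndepSets_iff_of_subset_E7 h hn hWE hW4).1 hW
  have hE7 : (((gr N).erase b).erase b').card = 7 := by
    rw [card_erase_of_mem (mem_erase.2 ⟨hbb'.symm, hb'⟩), card_erase_of_mem hb, hn]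
  have hYc : (((gr N).erase b).erase b' \ W).card = 3 := by rw [card_sdiff_of_subset hWE, hE7, hW4]
  have hYE : ((gr N).erase b).erase b' \ W ⊆ ((gr N).erase b).erase b' := sdiff_subset
  have e1 : (gr N \ W).erase b' = insert b (((gr N).erase b).erase b' \ W) := by
    ext x
    simp only [mem_erase, mem_sdiff, mem_insert]
    constructor
    · rintro ⟨hxb', hxg, hxW⟩
      by_cases hxb : x = b
      · exact Or.inl hxb
      · exact Or.inr ⟨⟨hxb', hxb, hxg⟩, hxW⟩
    · rintro (rfl | ⟨⟨hxb', hxb, hxg⟩, hxW⟩)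
      · exact ⟨hbb', hb, hbW⟩
      · exact ⟨hxb', hxg, hxW⟩
  rw [e1, insert_b_mem_biIndepSets_iff h hn hYE hYc, Finset.sdiff_sdiff_eq_self hWE, hWr]
  refine ⟨?_, rfl⟩
  have h1 := rk_insert_le_add_one hb' (insert_subset hb (hYE.trans ((erase_subset _ _).trans (erase_subset _ _))))
  have e2 : insert b' (insert b (((gr N).erase b).erase b' \ W)) = insert b (insert b' (((gr N).erase b).erase b' \ W)) := by
    ext x; simp only [mem_insert]; tauto
  rw [e2, hWc, rk_insert_left_eq_add_one_of_seriesPair h hYE] at h1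
  have h2 := rk_le_card' (M := N) (((gr N).erase b).erase b' \ W)
  rw [hYc] at h2
  omega

/-- **THE COMPLEMENT INJECTION**: for an OFF demand `W` (`(E ∖ W) − b′` bi-independent) the image
`(E ∖ W) − b′` is an OFF target: it contains `f` and avoids `e` and `b′`, and its own complement minus `b′` is `W`. -/
theorem compl_erase_erase {W : Finset α} (hW : W ∈ biIndepSets N 4) (hb'W : b' ∉ W) :
    (gr N \ (gr N \ W).erase b').erase b' = W := by
  have hWg : W ⊆ gr N := (mem_biIndepSets.1 hW).1
  ext x
  simp only [mem_erase, mem_sdiff]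
  constructor
  · rintro ⟨hxb', hxg, hx⟩
    by_contra hxW
    exact hx ⟨hxb', hxg, hxW⟩
  · intro hxW
    exact ⟨fun h' => hb'W (h' ▸ hxW), hWg hxW, fun h' => h'.2.2 hxW⟩

/-- **THE SWAP INJECTION**: for `W = Y + b ∈ BI_4(N)` with `z ∈ W ∌ f`, the set `W − z + f` is bi-independent (the series
swap of `R` lifted through `insert_b_mem_biIndepSets_iff`). -/
theorem swap_mem_of_seriesTwin (h : SeriesPair N b b') (hn : (gr N).card = 9) {f z : α} (hf : f ∈ gr N) (hz : z ∈ gr N)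
    (hfz : f ≠ z) (hfb : f ≠ b) (hfb' : f ≠ b') (hzb : z ≠ b) (hzb' : z ≠ b')
    (hH : rk N (((((gr N).erase b).erase b').erase f).erase z) = 3)
    (hf' : rk N ((((gr N).erase b).erase b').erase f) = 4) (hz' : rk N ((((gr N).erase b).erase b').erase z) = 4)
    {W : Finset α} (hW : W ∈ biIndepSets N 4) (hbW : b ∈ W) (hb'W : b' ∉ W) (hzW : z ∈ W) (hfW : f ∉ W) :
    insert f (W.erase z) ∈ biIndepSets N 4 := by
  have hbb' : b ≠ b' := h.2.2.1
  obtain ⟨hWg, hW4, -, -⟩ := mem_biIndepSets.1 hW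
  set Y := W.erase b with hYdef
  have hYE : Y ⊆ ((gr N).erase b).erase b' := by
    intro x hx
    rw [hYdef, mem_erase] at hx
    exact mem_erase.2 ⟨fun h' => hb'W (h' ▸ hx.2), mem_erase.2 ⟨hx.1, hWg hx.2⟩⟩
  have hY3 : Y.card = 3 := by rw [hYdef, card_erase_of_mem hbW, hW4]
  have hWY : W = insert b Y := by rw [hYdef, insert_erase hbW]
  rw [hWY] at hW
  obtain ⟨hYr, hYc⟩ := (insert_b_mem_biIndepSets_iff h hn hYE hY3).1 hW
  have hzY : z ∈ Y := mem_erase.2 ⟨hzb, hzW⟩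
  have hfY : f ∉ Y := fun h' => hfW (mem_of_mem_erase h')
  have hE7 : (((gr N).erase b).erase b').card = 7 := by
    rw [card_erase_of_mem (mem_erase.2 ⟨hbb'.symm, h.2.1⟩), card_erase_of_mem h.1, hn]
  obtain ⟨hr, hc⟩ := swap_rk_of_seriesTwin hf hz hfz hfb hfb' hzb hzb' hH hf' hz' hYE hzY hfY (by rw [hYr, hY3])
    (by rw [hYc, card_sdiff_of_subset hYE, hE7, hY3])
  have hY'E : insert f (Y.erase z) ⊆ ((gr N).erase b).erase b' :=
    insert_subset (mem_erase.2 ⟨hfb', mem_erase.2 ⟨hfb, hf⟩⟩) ((erase_subset _ _).trans hYE)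
  have hfY' : f ∉ Y.erase z := fun h' => hfY (mem_of_mem_erase h')
  have hY'3 : (insert f (Y.erase z)).card = 3 := by
    rw [card_insert_of_notMem hfY', card_erase_of_mem hzY, hY3]
  have e1 : insert f (W.erase z) = insert b (insert f (Y.erase z)) := by
    ext x
    simp only [hYdef, mem_insert, mem_erase]
    constructor
    · rintro (rfl | ⟨hxz, hxW⟩)
      · exact Or.inr (Or.inl rfl)
      · by_cases hxb : x = b
        · exact Or.inl hxb
        · exact Or.inr (Or.inr ⟨hxz, hxb, hxW⟩)
    · rintro (rfl | rfl | ⟨hxz, _, hxW⟩)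
      · exact Or.inr ⟨hzb.symm, hbW⟩
      · exact Or.inl rfl
      · exact Or.inr ⟨hxz, hxW⟩
  rw [e1, insert_b_mem_biIndepSets_iff h hn hY'E hY'3]
  refine ⟨by rw [hr, hY3], by rw [hc, card_sdiff_of_subset hYE, hE7, hY3]⟩

/-- **THE `H`-INJECTION**: for an ON demand `W = Y + b` with `Y ⊆ H := E₇ − f − z` (so `Y` spans `H` and
`ρ(Y ∪ {b, b′}) = 4`), put `P := H ∖ Y`.  Then `(P + f) + b` is bi-independent; if it is ON (`ρ(P ∪ {f, b, b′}) = 4`)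
it is the image, otherwise `Y + f` is bi-independent (the cut lemma) and is the image. -/
theorem h_images_of_seriesTwin (h : SeriesPair N b b') (hn : (gr N).card = 9) (hR : rk N (gr N) = 5)
    (hcf : ∀ x ∈ gr N, rk N ((gr N).erase x) = 5) {f z : α} (hf : f ∈ gr N) (hz : z ∈ gr N) (hfz : f ≠ z)
    (hfb : f ≠ b) (hfb' : f ≠ b') (hzb : z ≠ b) (hzb' : z ≠ b')
    (hH : rk N (((((gr N).erase b).erase b').erase f).erase z) = 3)
    (hf' : rk N ((((gr N).erase b).erase b').erase f) = 4) (hz' : rk N ((((gr N).erase b).erase b').erase z) = 4)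
    {Y : Finset α} (hY : Y ⊆ ((((gr N).erase b).erase b').erase f).erase z) (hY3 : Y.card = 3)
    (hW : insert b Y ∈ biIndepSets N 4) (hYon : rk N (insert b (insert b' Y)) = 4) :
    insert b (insert f (((((gr N).erase b).erase b').erase f).erase z \ Y)) ∈ biIndepSets N 4 ∧
      (rk N (insert b (insert b' (insert f (((((gr N).erase b).erase b').erase f).erase z \ Y)))) = 4 ∨
        insert f Y ∈ biIndepSets N 4) := by
  have hb : b ∈ gr N := h.1
  have hb' : b' ∈ gr N := h.2.1
  have hbb' : b ≠ b' := h.2.2.1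
  set H := ((((gr N).erase b).erase b').erase f).erase z with hHdef
  set P := H \ Y with hPdef
  have hHE : H ⊆ ((gr N).erase b).erase b' := (erase_subset _ _).trans (erase_subset _ _)
  have hYE : Y ⊆ ((gr N).erase b).erase b' := hY.trans hHE
  have hPH : P ⊆ H := sdiff_subset
  have hPE : P ⊆ ((gr N).erase b).erase b' := hPH.trans hHE
  obtain ⟨hYr, hYc⟩ := (insert_b_mem_biIndepSets_iff h hn hYE hY3).1 hW
  have hE7 : (((gr N).erase b).erase b').card = 7 := by
    rw [card_erase_of_mem (mem_erase.2 ⟨hbb'.symm, hb'⟩), card_erase_of_mem hb, hn]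
  have hHc : H.card = 5 := by
    rw [hHdef, card_erase_of_mem (show z ∈ (((gr N).erase b).erase b').erase f from
      mem_erase.2 ⟨hfz.symm, mem_erase.2 ⟨hzb', mem_erase.2 ⟨hzb, hz⟩⟩⟩),
      card_erase_of_mem (show f ∈ ((gr N).erase b).erase b' from mem_erase.2 ⟨hfb', mem_erase.2 ⟨hfb, hf⟩⟩), hE7]
  have hPc : P.card = 2 := by rw [hPdef, card_sdiff_of_subset hY, hHc, hY3]
  have hfY : f ∉ Y := fun h' => (mem_erase.1 (mem_erase.1 (hY h')).2).1 rfl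
  have hzY : z ∉ Y := fun h' => (mem_erase.1 (hY h')).1 rfl
  have hfP : f ∉ P := fun h' => (mem_erase.1 (mem_erase.1 (hPH h')).2).1 rfl
  have hzP : z ∉ P := fun h' => (mem_erase.1 (hPH h')).1 rfl
  -- `E₇ ∖ Y = P ∪ {f, z}`, so `P` is independent
  have hE7Y : ((gr N).erase b).erase b' \ Y = insert f (insert z P) := by
    ext x
    simp only [mem_sdiff, mem_insert, hPdef, hHdef, mem_erase]
    constructor
    · rintro ⟨⟨hxb', hxb, hxg⟩, hxY⟩
      by_cases hxf : x = f
      · exact Or.inl hxf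
      by_cases hxz : x = z
      · exact Or.inr (Or.inl hxz)
      exact Or.inr (Or.inr ⟨⟨hxz, hxf, hxb', hxb, hxg⟩, hxY⟩)
    · rintro (rfl | rfl | ⟨⟨hxz, hxf, hxb', hxb, hxg⟩, hxY⟩)
      · exact ⟨⟨hfb', hfb, hf⟩, hfY⟩
      · exact ⟨⟨hzb', hzb, hz⟩, hzY⟩
      · exact ⟨⟨hxb', hxb, hxg⟩, hxY⟩
  have hPr : rk N P = 2 := by
    have h1 : rk N (((gr N).erase b).erase b' \ Y) = (((gr N).erase b).erase b' \ Y).card := by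
      rw [hYc, card_sdiff_of_subset hYE, hE7, hY3]
    rw [rk_eq_card_of_subset_of_rk_eq_card (by rw [hE7Y]; exact (subset_insert _ _).trans (subset_insert _ _)) h1, hPc]
  -- the first image `(P + f) + b`
  have hPfE : insert f P ⊆ ((gr N).erase b).erase b' := insert_subset (mem_erase.2 ⟨hfb', mem_erase.2 ⟨hfb, hf⟩⟩) hPE
  have hPf3 : (insert f P).card = 3 := by rw [card_insert_of_notMem hfP, hPc]
  have e2 : ((gr N).erase b).erase b' \ insert f P = insert z Y := by
    ext x
    simp only [mem_sdiff, mem_insert, hPdef, hHdef, mem_erase, not_or]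
    constructor
    · rintro ⟨⟨hxb', hxb, hxg⟩, hxf, hxP⟩
      by_cases hxz : x = z
      · exact Or.inl hxz
      · exact Or.inr (by_contra fun hxY => hxP ⟨⟨hxz, hxf, hxb', hxb, hxg⟩, hxY⟩)
    · rintro (rfl | hxY)
      · exact ⟨⟨hzb', hzb, hz⟩, hfz.symm, fun h' => h'.1.1 rfl⟩
      · have hx' := hYE hxY
        rw [mem_erase, mem_erase] at hx'
        exact ⟨hx', fun h' => hfY (h' ▸ hxY), fun h' => h'.2 hxY⟩
  have him1 : insert b (insert f P) ∈ biIndepSets N 4 := by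
    rw [insert_b_mem_biIndepSets_iff h hn hPfE hPf3, rk_insert_f_eq_add_one_of_subset_H hf hfz hfb hfb' hH hz' hPH, hPr,
      e2, rk_insert_z_eq_add_one_of_subset_H hz hfz hzb hzb' hH hf' hY, hYr]
    exact ⟨rfl, rfl⟩
  refine ⟨him1, ?_⟩
  by_cases hon : rk N (insert b (insert b' (insert f P))) = 4
  · exact Or.inl hon
  · right
    -- `(P + f) + b + b′` has rank `5`, so by the cut lemma `(P + z) + b + b′` has rank `5` too, and `Y + f` is bi-independent
    have hPz : rk N (insert b (insert b' (insert z P))) = 5 := by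
      by_contra hne
      have h5 : rk N (insert b (insert b' (insert z P))) ≤ 5 := by
        have := rk_mono' (M := N) (show insert b (insert b' (insert z P)) ⊆ gr N from
          insert_subset hb (insert_subset hb' (insert_subset hz (hPE.trans ((erase_subset _ _).trans (erase_subset _ _))))))
        omega
      have h4 : 4 ≤ rk N (insert b (insert b' (insert z P))) := by
        have h1 : rk N (insert b (insert z P)) = 4 := by
          rw [rk_insert_left_eq_add_one_of_seriesPair h (insert_subset (mem_erase.2 ⟨hzb', mem_erase.2 ⟨hzb, hz⟩⟩) hPE),
            rk_insert_z_eq_add_one_of_subset_H hz hfz hzb hzb' hH hf' hPH, hPr]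
        rw [← h1]
        exact rk_mono' (M := N) (insert_subset_insert b (subset_insert b' _))
      have hPz4 : rk N (insert b (insert b' (insert z P))) = 4 := by omega
      exact hon (cut_lemma h hcf hf hz hfz hfb hfb' hzb hzb' hH hz' hY hYr hPr hYon hPz4)
    have hfYE : insert f Y ⊆ ((gr N).erase b).erase b' := insert_subset (mem_erase.2 ⟨hfb', mem_erase.2 ⟨hfb, hf⟩⟩) hYE
    have hfY4 : (insert f Y).card = 4 := by rw [card_insert_of_notMem hfY, hY3]
    have e3 : ((gr N).erase b).erase b' \ insert f Y = insert z P := by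
      ext x
      simp only [mem_sdiff, mem_insert, hPdef, hHdef, mem_erase, not_or]
      constructor
      · rintro ⟨⟨hxb', hxb, hxg⟩, hxf, hxY⟩
        by_cases hxz : x = z
        · exact Or.inl hxz
        · exact Or.inr ⟨⟨hxz, hxf, hxb', hxb, hxg⟩, hxY⟩
      · rintro (rfl | ⟨⟨hxz, hxf, hxb', hxb, hxg⟩, hxY⟩)
        · exact ⟨⟨hzb', hzb, hz⟩, hfz.symm, hzY⟩
        · exact ⟨⟨hxb', hxb, hxg⟩, hxf, hxY⟩
    rw [mem_biIndepSets_iff_of_subset_E7 h hn hfYE hfY4, rk_insert_f_eq_add_one_of_subset_H hf hfz hfb hfb' hH hz' hY, hYr,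
      e3]
    exact ⟨rfl, hPz⟩

end StarSharpT

end PercRepro.Cogirth
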